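import Summits.KontsevichZagierPeriods.Zeta5Search.Certificates.RayKernelMultiplier
import Summits.KontsevichZagierPeriods.Zeta5Search.Certificates.DualSeriesTermBounds
import HarnessLib

/-!
# ζ(5) search — certificates: admissibility of NATURAL dual parameters for the generic kernel multiplier (TYPER g16)

HONEST FRAMING: systematic search; no irrationality claim unless certified.  Pure bookkeeping, nothing about `ζ(5)`.

OUR work (Summit side; typer seat, generation 16).  The T1-map rays of P1 g11 (`RayH1Forms`, `RayC5Forms`, `RayC1Forms`)
write their dual parameters as `natB B₀ B` (`Certificates/DualSeriesTermBounds`): `b₀ = B₀`, `b_{j+1} = B j`.  This file reads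
the hypotheses `SharpAdmissible` of `Certificates/RayKernelMultiplier` in that format:

* `bn_natB_zero`, `bn_natB_succ` — the natural slots `bn (natB B₀ B) 0 = B₀`, `bn (natB B₀ B) (j+1) = B j`;
* `sharpAdmissible_natB` — `B j ≤ B₀`, the six pair sums `B 0 + B 5, B 6 + B 0, B 1 + B 6, B 5 + B 3, B 3 + B 4, B 4 + B 2 ≤ B₀`
  (pairs `16, 71, 27, 64, 45, 53` of (35)) and `Σ_j B j ≤ 3B₀ + 1` give `SharpAdmissible (natB B₀ B)`;
* `sharpNormaliser_cast_pos` — `0 < N♯(b)` as a real number (a ratio of factorials).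
-/

noncomputable section

open Finset

namespace Summit.KontsevichZagierPeriods.Zeta5Search.RayKernel

open Summit.KontsevichZagierPeriods.Zeta5Search.DualSeries
open Summit.KontsevichZagierPeriods.Zeta5Search.DualSeriesDenominators
open Summit.KontsevichZagierPeriods.Zeta5Search.DualSeriesBounds (natB natB_zero natB_succ inBox_natB)

variable {B₀ : ℕ} {B : ℕ → ℕ}

/-- `bn (natB B₀ B) 0 = B₀`. -/
theorem bn_natB_zero (B₀ : ℕ) (B : ℕ → ℕ) : bn (natB B₀ B) 0 = B₀ := by
  unfold bn; rw [natB_zero]; exact Int.toNat_natCast _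

/-- `bn (natB B₀ B) (j+1) = B j` for `j < 7`. -/
theorem bn_natB_succ (B₀ : ℕ) (B : ℕ → ℕ) {j : ℕ} (hj : j < 7) : bn (natB B₀ B) (j + 1) = B j := by
  unfold bn; rw [natB_succ B₀ B (mem_range.2 hj)]; exact Int.toNat_natCast _

/-- The integer sum `Σ_j b_{j+1}` of `natB B₀ B` is the natural sum `Σ_j B j`. -/
theorem sum_natB_succ (B₀ : ℕ) (B : ℕ → ℕ) :
    ∑ j ∈ range 7, natB B₀ B (j + 1) = ((∑ j ∈ range 7, B j : ℕ) : ℤ) := by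
  push_cast
  exact sum_congr rfl fun j hj => natB_succ B₀ B hj

/-- `N♯(b) > 0` as a real number, for every `b` (a ratio of factorials). -/
theorem sharpNormaliser_cast_pos (b : ℕ → ℤ) : (0 : ℝ) < ((sharpNormaliser b : ℚ) : ℝ) := by
  have h : (0 : ℚ) < sharpNormaliser b := by
    unfold sharpNormaliser normaliser
    exact div_pos (by exact_mod_cast prod_pos fun s _ => Nat.factorial_pos _)
      (by exact_mod_cast mul_pos (Nat.factorial_pos _) (Nat.factorial_pos _))
  exact_mod_cast h

/-- **Admissibility in the `natB` format.**  Slots below `B₀`, the six pair sums of (35) below `B₀`, and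
`Σ_j B j ≤ 3B₀ + 1` give `SharpAdmissible (natB B₀ B)`. -/
theorem sharpAdmissible_natB (hle : ∀ j ∈ range 7, B j ≤ B₀)
    (hpairs : B 0 + B 5 ≤ B₀ ∧ B 6 + B 0 ≤ B₀ ∧ B 1 + B 6 ≤ B₀ ∧ B 5 + B 3 ≤ B₀ ∧ B 3 + B 4 ≤ B₀ ∧ B 4 + B 2 ≤ B₀)
    (hsum : ∑ j ∈ range 7, B j ≤ 3 * B₀ + 1) : SharpAdmissible (natB B₀ B) := by
  refine ⟨inBox_natB hle, ?_, ?_⟩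
  · obtain ⟨p0, p1, p2, p3, p4, p5⟩ := hpairs
    intro s hs
    interval_cases s <;> simp only [pfst, psnd] <;> rw [bn_natB_zero]
    · rw [bn_natB_succ B₀ B (j := 0) (by norm_num), bn_natB_succ B₀ B (j := 5) (by norm_num)]; exact p0
    · rw [bn_natB_succ B₀ B (j := 6) (by norm_num), bn_natB_succ B₀ B (j := 0) (by norm_num)]; exact p1
    · rw [bn_natB_succ B₀ B (j := 1) (by norm_num), bn_natB_succ B₀ B (j := 6) (by norm_num)]; exact p2
    · rw [bn_natB_succ B₀ B (j := 5) (by norm_num), bn_natB_succ B₀ B (j := 3) (by norm_num)]; exact p3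
    · rw [bn_natB_succ B₀ B (j := 3) (by norm_num), bn_natB_succ B₀ B (j := 4) (by norm_num)]; exact p4
    · rw [bn_natB_succ B₀ B (j := 4) (by norm_num), bn_natB_succ B₀ B (j := 2) (by norm_num)]; exact p5
  · rw [sum_natB_succ, natB_zero]
    exact_mod_cast hsum

end Summit.KontsevichZagierPeriods.Zeta5Search.RayKernel
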